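import Summits.QuantumFields.BalabanUV.T4Continuum.Support.NE7LinOneStepAbelian
import HarnessLib

/-!
# NE7LinOneStepAbstract — THE SHAPE OF LIN-ONE-STEP AS AN INTERFACE: any gauge-covariant, exponentially local linear response `T` of a
# coarse 1-form datum is bounded pointwise by `C·Φ(B)` as soon as every datum has a representative modulo the invisible data with
# polynomial growth `≤ c₀(1 + dist)²·Φ(B)` around any base point — the three hypotheses the CURVED-BACKGROUND re-run must supply

Cell `pub-balaban`, rung (B)+1 sub-cell t4, lineage `b2b-balaban-t4-ne7-p1`, generation 65 (CRUX PROVER NE7 #1); hunt (h9), step (h9-ii) of memo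
`t4/b2b-balaban-t4-ne7-p1-g65/HUNT-H9-LIN-ONE-STEP.md` §3.  File D (after A ∕ B1 ∕ B2a ∕ B2b ∕ C of this generation).

WHY.  `NE7LinOneStepAbelian.norm_curl_HkOp_le_curl` (file C) proves the abelian flat LIN-ONE-STEP from exactly three ingredients: (G) GAUGE
COVARIANCE — `curl H_k` does not see exact + constant coarse data (file A); (K) LOCALITY — the response at a fine point `x` is a kernel sum
`≤ K·Σ_y e^{−κ·dist_T(x̄,y)}·Σ_λ|B(y,λ)|` over the coarse torus, `x̄` the block of `x` (lit-balaban's `norm_dker_bpt_le`, [Balaban1984PropagatorsII]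
Cor. 2.8); (P) a CONE GAUGE — every datum is, modulo invisible data, a field growing at most like `c₀(1 + dist_T(y,y₀))²·Φ(B)` around any
`y₀` (file B2b, `Φ(B) = sup|F(B)|`).  The non-abelian ONE-STEP ([Balaban1985Variational] Thm 1 (8), Sect. F) needs the same three at a CURVED
background `U₀ ≠ 1`: (G) for the covariant pure gauges, (K) = Thm 3.12 of B11's ref. [5] ([Balaban1985BackgroundPropagators], CMP 99 — a
displayed hypothesis in lit-balaban's B11 chain), (P) = the covariant cone gauge ([tree] `B7Prop1Explicit.axial_bond_bound` is the group-valued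
`ℤ^d` version).  THIS FILE records the bookkeeping ONCE over ABSTRACT data, so that the curved-background re-run is «supply (G), (K), (P)»:
* **`norm_response_le_of_covariant_local_cone`** — for any response `T : (coarse 1-forms) → (X → ℂ)` with a block map `blk : X → Tor M`, any
  predicate `Inv` of invisible data with (G) `Inv (B − B′) → T B x = T B′ x`, (K) the kernel bound with constants `K ≥ 0`, `κ > 0`, and (P) the cone
  representatives with constant `c₀` and size functional `Φ`: `|T B x| ≤ K·(d+1)·c₀·(2 + 32∕κ²)·K_{d+1}(κ∕2)·Φ(B)` at every `x` — uniformly in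
  the period vector `M` (the volume-uniform torus sum of lit-balaban, `sum_exp_torusSupNorm_sub_rep_le`, via file C's `sum_exp_sq_le`).
The abelian instance (`T B x := F_{μν}(H_kB)(x)` componentwise, `Inv := exact + constant`, `Φ := sup|F|`, `K = CdecD·(d+1)`-type, `c₀ = 2(d+1)`) is
file C; it is not re-derived here.
HONEST FRAMING (page 1): [folklore] summation bookkeeping over HYPOTHESES (G), (K), (P) — asserted for no concrete curved-background datum; 0 def,
0 sorry; NOT ONE-STEP, NOT NE7; spine 0∕9; finite T⁴ rung (B)+1 — NOT infinite volume, NOT mass gap, NOT Clay.  Continuum YM on T⁴ ⇐ BetaPertH ∧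
nine spine estimates (0/9 proved); BetaPertH ⇐ (D1) ∧ (D4) ∧ CAP+tail; G-an2-4 gates asym, D1 and NE2/3/4.
-/

set_option autoImplicit false

noncomputable section

open Finset

namespace Summit.QuantumFields.BalabanUV.T4Continuum.NE7LinOneStepAbstract

open Literature.MathematicalPhysics.QuantumFieldTheory.Balaban1983to89
open B4TorusKernel.MultiPeriod (torusSupNorm torusSupNorm_nonneg)
open B4Sect5Proof (latticeConst latticeConst_nonneg)
open B5Prop11Plancherel (Tor)
open B6LowerBound2153Torus (rep)
open B6Cov2156Torus (one_le_M)
open NE7LinOneStepAbelian (sum_exp_sq_le)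

variable {d : ℕ} (M : Fin (d + 1) → ℕ) [hM : ∀ μ, NeZero (M μ)] {X : Type*}

/-- **LIN-ONE-STEP AS AN INTERFACE.**  Let `T` send coarse 1-forms on `Tor M` to functions on a set `X` of fine evaluation points with block map
`blk : X → Tor M`; assume (G) GAUGE COVARIANCE `Inv (B − B′) → T B x = T B′ x`, (K) LOCALITY `|T B x| ≤ K·Σ_y e^{−κ·dist_T(blk x, y)}·Σ_λ|B(y,λ)|`,
(P) CONE REPRESENTATIVES `∀ B y₀, ∃ B′, Inv (B − B′) ∧ |B′(y,λ)| ≤ c₀·(1 + dist_T(y,y₀))²·Φ(B)`.  Then `|T B x| ≤ K·(d+1)·c₀·(2 + 32∕κ²)·K_{d+1}(κ∕2)·Φ(B)`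
at every `x`, uniformly in `M`. [folklore] -/
theorem norm_response_le_of_covariant_local_cone
    (T : (Tor M × Fin (d + 1) → ℂ) → X → ℂ) (blk : X → Tor M) (Inv : (Tor M × Fin (d + 1) → ℂ) → Prop)
    (Φ : (Tor M × Fin (d + 1) → ℂ) → ℝ) {K κ c₀ : ℝ} (hK : 0 ≤ K) (hκ : 0 < κ) (hc₀ : 0 ≤ c₀)
    (hG : ∀ B B' x, Inv (B - B') → T B x = T B' x)
    (hKer : ∀ B x, ‖T B x‖ ≤ K * ∑ y : Tor M,
        Real.exp (-(κ * torusSupNorm M (rep M (blk x) - rep M y))) * ∑ lam : Fin (d + 1), ‖B (y, lam)‖)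
    (hP : ∀ (B : Tor M × Fin (d + 1) → ℂ) (y₀ : Tor M), ∃ B' : Tor M × Fin (d + 1) → ℂ, Inv (B - B') ∧
        ∀ y lam, ‖B' (y, lam)‖ ≤ c₀ * (1 + torusSupNorm M (rep M y - rep M y₀)) ^ 2 * Φ B)
    (B : Tor M × Fin (d + 1) → ℂ) (hΦ : 0 ≤ Φ B) (x : X) :
    ‖T B x‖ ≤ K * (((d : ℝ) + 1) * c₀ * ((2 + 32 / κ ^ 2) * latticeConst (d + 1) (κ / 2))) * Φ B := by
  obtain ⟨B', hinv, hB'⟩ := hP B (blk x)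
  rw [hG B B' x hinv]
  refine (hKer B' x).trans ?_
  have hS := sum_exp_sq_le M hκ (blk x)
  -- each coarse point contributes `(d+1)·c₀·(1+dist)²·Φ(B)` against the kernel weight
  have hinner : ∀ y : Tor M, ∑ lam : Fin (d + 1), ‖B' (y, lam)‖
      ≤ ((d : ℝ) + 1) * (c₀ * (1 + torusSupNorm M (rep M y - rep M (blk x))) ^ 2 * Φ B) := by
    intro y
    calc ∑ lam : Fin (d + 1), ‖B' (y, lam)‖
        ≤ ∑ _lam : Fin (d + 1), c₀ * (1 + torusSupNorm M (rep M y - rep M (blk x))) ^ 2 * Φ B :=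
          Finset.sum_le_sum fun lam _ => hB' y lam
      _ = ((d : ℝ) + 1) * (c₀ * (1 + torusSupNorm M (rep M y - rep M (blk x))) ^ 2 * Φ B) := by
          rw [Finset.sum_const, Finset.card_univ, Fintype.card_fin, nsmul_eq_mul]; push_cast; ring
  calc K * ∑ y : Tor M, Real.exp (-(κ * torusSupNorm M (rep M (blk x) - rep M y))) * ∑ lam : Fin (d + 1), ‖B' (y, lam)‖
      ≤ K * ∑ y : Tor M, Real.exp (-(κ * torusSupNorm M (rep M (blk x) - rep M y)))
          * (((d : ℝ) + 1) * (c₀ * (1 + torusSupNorm M (rep M y - rep M (blk x))) ^ 2 * Φ B)) := by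
        refine mul_le_mul_of_nonneg_left (Finset.sum_le_sum fun y _ => ?_) hK
        exact mul_le_mul_of_nonneg_left (hinner y) (Real.exp_pos _).le
    _ = K * (((d : ℝ) + 1) * c₀ * Φ B) * ∑ y : Tor M, Real.exp (-(κ * torusSupNorm M (rep M (blk x) - rep M y)))
          * (1 + torusSupNorm M (rep M y - rep M (blk x))) ^ 2 := by
        rw [Finset.mul_sum, Finset.mul_sum]
        refine Finset.sum_congr rfl fun y _ => ?_
        ring
    _ ≤ K * (((d : ℝ) + 1) * c₀ * Φ B) * ((2 + 32 / κ ^ 2) * latticeConst (d + 1) (κ / 2)) :=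
        mul_le_mul_of_nonneg_left hS (by positivity)
    _ = K * (((d : ℝ) + 1) * c₀ * ((2 + 32 / κ ^ 2) * latticeConst (d + 1) (κ / 2))) * Φ B := by ring

end Summit.QuantumFields.BalabanUV.T4Continuum.NE7LinOneStepAbstract
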